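import Mathlib
import Summits.AtomisticToContinuum.FouriersLaw.Theses.EmbeddedDrudeMourre
import Literature.MathematicalPhysics.KineticTheory.ZeroWavenumberSpace
import Literature.MathematicalPhysics.KineticTheory.InfiniteChainSuperstableDynamics
import Summits.AtomisticToContinuum.FouriersLaw.Theorems.EmbeddedDrudeMourreMourreDissolutionAbelFloor
import HarnessLib

/-!
# `EmbeddedDrudeMourre.MourreDissolution`, line `separable-vertex-faddeev-pair-sector` —
# helpers for stub `stub_fgrPositivity` (part 4/4): the stub is EQUIVALENT to its trial-vector form

Item `stmt-AtomisticToContinuum-12594` (crux `MourreDissolution` of route `EmbeddedDrudeMourre`,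
sub-problem `FouriersLaw`), registered stub `stub_fgrPositivity` (S7) of the line skeleton
`Cruxes/MourreDissolution/Lines/separable_vertex_faddeev_pair_sector.lean`:

  (S7) for `ω₂ lam β γ > 0` under `HasOddSectorGap ω₂ lam β` there is `T₀ > 0` such that for
  `T ∈ (0, T₀)` and every regular Θ-symmetric zero-wavenumber framework `(D, Z)` of
  `pinnedChain ω₂ lam β γ` at temperature `T` (BM carrier, DLR Gibbs, superstable, momentum
  reversal, strongly continuous Koopman group) the Abel functional is uniformly bounded below,
  `∃ c ν₀ > 0, ∀ ν ∈ (0, ν₀), c ≤ A_T(ν) := ∫₀^∞ e^{-νt} C_T(t) dt`.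

S7 is NOT proved here (it is the lower-bound half of the post-kinetic Green–Kubo conjecture; the
missing ingredient is the Fermi-golden-rule identification of the zero-frequency boundary value,
not in the tree). What this file machine-checks is that its ONLY content is STATIC: by the exact
variational duality on `ℋ₀` (parts 1/4–2/4, `ZeroWavenumberData.abelFunctional_floor_iff_trialVectors`)
S7 is equivalent — same parameters, same `T₀`, same framework hypotheses, same `c, ν₀` — to

  (TV) `∃ c ν₀ > 0, ∀ ν ∈ (0, ν₀), ∃ φ_ν ∈ D(𝓛♮), c ≤ 2⟪[J], φ_ν⟫₀ - ν‖φ_ν‖₀² - ν⁻¹‖𝓛♮φ_ν‖₀²`,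

the existence of approximate zero-modes of the generator `𝓛♮ = Z.generator` at scale `ν`
overlapping the current class `[J] = Z.currentClass` ("all-orders dressed odd charges"; a
finite-degree trial space only certifies `O(ν/λ²)`): `stub_fgrPositivity_of_trialVectors`
(TV ⟹ S7, the registered headline of this file), `trialVectors_of_stub_fgrPositivity` (S7 ⟹ TV)
and `stub_fgrPositivity_iff_trialVectors`. The right-hand side of the headline is the registered
signature of `stub_fgrPositivity` verbatim, so the skeleton may discharge S7 by
`stub_fgrPositivity_of_trialVectors h` from any proof `h` of (TV). All proofs `[folklore]`.
-/

noncomputable section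

namespace Summit.AtomisticToContinuum.FouriersLaw.Theorems.MourreDissolution

open Filter Topology MeasureTheory Set
open scoped InnerProductSpace
open Literature.MathematicalPhysics.KineticTheory.HeatConduction
open Literature.MathematicalPhysics.KineticTheory

/-- **Headline (registered helper stub of `stmt-AtomisticToContinuum-12594`): trial vectors imply
Stub 7.** If under the hypotheses of `stub_fgrPositivity` there are `c ν₀ > 0` and, for every
`ν ∈ (0, ν₀)`, a trial vector `φ_ν ∈ D(𝓛♮)` with
`c ≤ 2⟪[J], φ_ν⟫₀ - ν‖φ_ν‖₀² - ν⁻¹‖𝓛♮φ_ν‖₀²`, then the registered conclusion of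
`stub_fgrPositivity` holds with the same `T₀, c, ν₀` (variational lower bound
`ZeroWavenumberData.abelFunctional_floor_of_trialVectors`). [folklore] -/
theorem stub_fgrPositivity_of_trialVectors :
    (∀ ω₂ lam β γ : ℝ, 0 < ω₂ → 0 < lam → 0 < β → 0 < γ →
      Literature.MathematicalPhysics.KineticTheory.PhononBoltzmann.HasOddSectorGap ω₂ lam β →
      ∃ T₀ : ℝ, 0 < T₀ ∧ ∀ T : ℝ, 0 < T → T < T₀ →
        ∀ (D : Literature.MathematicalPhysics.KineticTheory.HeatConduction.InfiniteChainDynamics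
            (Literature.MathematicalPhysics.KineticTheory.HeatConduction.pinnedChain ω₂ lam β γ))
          (Z : Literature.MathematicalPhysics.KineticTheory.HeatConduction.ZeroWavenumberData
            (Literature.MathematicalPhysics.KineticTheory.HeatConduction.pinnedChain ω₂ lam β γ) D),
          D.carrier =
              (Literature.MathematicalPhysics.KineticTheory.HeatConduction.pinnedChain
                ω₂ lam β γ).bmGood →
          (Literature.MathematicalPhysics.KineticTheory.HeatConduction.pinnedChain
              ω₂ lam β γ).IsChainGibbsMeasure T Z.μ →
          (Literature.MathematicalPhysics.KineticTheory.HeatConduction.pinnedChain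
              ω₂ lam β γ).HasSuperstabilityEstimate Z.μ →
          Z.HasMomentumReversal →
          (∀ ψ : Literature.MathematicalPhysics.KineticTheory.HeatConduction.ZeroWavenumberSpace Z,
            Continuous fun t : ℝ => Z.koopman t ψ) →
          ∃ c ν₀ : ℝ, 0 < c ∧ 0 < ν₀ ∧ ∀ ν : ℝ, 0 < ν → ν < ν₀ →
            ∃ (φ : Literature.MathematicalPhysics.KineticTheory.HeatConduction.ZeroWavenumberSpace Z)
              (hφ : φ ∈ Z.toFluctuationDynamics.generatorDomain),
              c ≤ 2 * ⟪Z.currentClass, φ⟫_ℝ - ν * ‖φ‖ ^ 2 - ν⁻¹ * ‖Z.generator ⟨φ, hφ⟩‖ ^ 2) →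
    ∀ ω₂ lam β γ : ℝ, 0 < ω₂ → 0 < lam → 0 < β → 0 < γ →
      Literature.MathematicalPhysics.KineticTheory.PhononBoltzmann.HasOddSectorGap ω₂ lam β →
      ∃ T₀ : ℝ, 0 < T₀ ∧ ∀ T : ℝ, 0 < T → T < T₀ →
        ∀ (D : Literature.MathematicalPhysics.KineticTheory.HeatConduction.InfiniteChainDynamics
            (Literature.MathematicalPhysics.KineticTheory.HeatConduction.pinnedChain ω₂ lam β γ))
          (Z : Literature.MathematicalPhysics.KineticTheory.HeatConduction.ZeroWavenumberData
            (Literature.MathematicalPhysics.KineticTheory.HeatConduction.pinnedChain ω₂ lam β γ) D),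
          D.carrier =
              (Literature.MathematicalPhysics.KineticTheory.HeatConduction.pinnedChain
                ω₂ lam β γ).bmGood →
          (Literature.MathematicalPhysics.KineticTheory.HeatConduction.pinnedChain
              ω₂ lam β γ).IsChainGibbsMeasure T Z.μ →
          (Literature.MathematicalPhysics.KineticTheory.HeatConduction.pinnedChain
              ω₂ lam β γ).HasSuperstabilityEstimate Z.μ →
          Z.HasMomentumReversal →
          (∀ ψ : Literature.MathematicalPhysics.KineticTheory.HeatConduction.ZeroWavenumberSpace Z,
            Continuous fun t : ℝ => Z.koopman t ψ) →
          ∃ c ν₀ : ℝ, 0 < c ∧ 0 < ν₀ ∧ ∀ ν : ℝ, 0 < ν → ν < ν₀ →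
            c ≤ MeasureTheory.integral (MeasureTheory.volume.restrict (Set.Ioi (0:ℝ)))
              (fun t : ℝ => Real.exp (-(ν * t)) * D.currentCorrelation Z.μ t) := by
  intro hTV ω₂ lam β γ hω₂ hlam hβ hγ hH
  obtain ⟨T₀, hT₀, hT⟩ := hTV ω₂ lam β γ hω₂ hlam hβ hγ hH
  refine ⟨T₀, hT₀, fun T hTpos hTlt D Z hcar hGibbs hSS hRev hsc => ?_⟩
  obtain ⟨c, ν₀, hc, hν₀, htv⟩ := hT T hTpos hTlt D Z hcar hGibbs hSS hRev hsc
  exact ⟨c, ν₀, hc, hν₀, Z.abelFunctional_floor_of_trialVectors hRev hsc htv⟩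

/-- **Stub 7 implies trial vectors** (the converse, by attainment of the variational bound,
`ZeroWavenumberData.trialVectors_of_abelFunctional_floor`): from the registered conclusion of
`stub_fgrPositivity` one gets, with the same `T₀, c, ν₀`, trial vectors `φ_ν ∈ D(𝓛♮)` with
`c ≤ 2⟪[J], φ_ν⟫₀ - ν‖φ_ν‖₀² - ν⁻¹‖𝓛♮φ_ν‖₀²` for all `ν ∈ (0, ν₀)`. [folklore] -/
theorem trialVectors_of_stub_fgrPositivity :
    (∀ ω₂ lam β γ : ℝ, 0 < ω₂ → 0 < lam → 0 < β → 0 < γ →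
      Literature.MathematicalPhysics.KineticTheory.PhononBoltzmann.HasOddSectorGap ω₂ lam β →
      ∃ T₀ : ℝ, 0 < T₀ ∧ ∀ T : ℝ, 0 < T → T < T₀ →
        ∀ (D : Literature.MathematicalPhysics.KineticTheory.HeatConduction.InfiniteChainDynamics
            (Literature.MathematicalPhysics.KineticTheory.HeatConduction.pinnedChain ω₂ lam β γ))
          (Z : Literature.MathematicalPhysics.KineticTheory.HeatConduction.ZeroWavenumberData
            (Literature.MathematicalPhysics.KineticTheory.HeatConduction.pinnedChain ω₂ lam β γ) D),
          D.carrier =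
              (Literature.MathematicalPhysics.KineticTheory.HeatConduction.pinnedChain
                ω₂ lam β γ).bmGood →
          (Literature.MathematicalPhysics.KineticTheory.HeatConduction.pinnedChain
              ω₂ lam β γ).IsChainGibbsMeasure T Z.μ →
          (Literature.MathematicalPhysics.KineticTheory.HeatConduction.pinnedChain
              ω₂ lam β γ).HasSuperstabilityEstimate Z.μ →
          Z.HasMomentumReversal →
          (∀ ψ : Literature.MathematicalPhysics.KineticTheory.HeatConduction.ZeroWavenumberSpace Z,
            Continuous fun t : ℝ => Z.koopman t ψ) →
          ∃ c ν₀ : ℝ, 0 < c ∧ 0 < ν₀ ∧ ∀ ν : ℝ, 0 < ν → ν < ν₀ →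
            c ≤ MeasureTheory.integral (MeasureTheory.volume.restrict (Set.Ioi (0:ℝ)))
              (fun t : ℝ => Real.exp (-(ν * t)) * D.currentCorrelation Z.μ t)) →
    ∀ ω₂ lam β γ : ℝ, 0 < ω₂ → 0 < lam → 0 < β → 0 < γ →
      Literature.MathematicalPhysics.KineticTheory.PhononBoltzmann.HasOddSectorGap ω₂ lam β →
      ∃ T₀ : ℝ, 0 < T₀ ∧ ∀ T : ℝ, 0 < T → T < T₀ →
        ∀ (D : Literature.MathematicalPhysics.KineticTheory.HeatConduction.InfiniteChainDynamics
            (Literature.MathematicalPhysics.KineticTheory.HeatConduction.pinnedChain ω₂ lam β γ))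
          (Z : Literature.MathematicalPhysics.KineticTheory.HeatConduction.ZeroWavenumberData
            (Literature.MathematicalPhysics.KineticTheory.HeatConduction.pinnedChain ω₂ lam β γ) D),
          D.carrier =
              (Literature.MathematicalPhysics.KineticTheory.HeatConduction.pinnedChain
                ω₂ lam β γ).bmGood →
          (Literature.MathematicalPhysics.KineticTheory.HeatConduction.pinnedChain
              ω₂ lam β γ).IsChainGibbsMeasure T Z.μ →
          (Literature.MathematicalPhysics.KineticTheory.HeatConduction.pinnedChain
              ω₂ lam β γ).HasSuperstabilityEstimate Z.μ →
          Z.HasMomentumReversal →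
          (∀ ψ : Literature.MathematicalPhysics.KineticTheory.HeatConduction.ZeroWavenumberSpace Z,
            Continuous fun t : ℝ => Z.koopman t ψ) →
          ∃ c ν₀ : ℝ, 0 < c ∧ 0 < ν₀ ∧ ∀ ν : ℝ, 0 < ν → ν < ν₀ →
            ∃ (φ : Literature.MathematicalPhysics.KineticTheory.HeatConduction.ZeroWavenumberSpace Z)
              (hφ : φ ∈ Z.toFluctuationDynamics.generatorDomain),
              c ≤ 2 * ⟪Z.currentClass, φ⟫_ℝ - ν * ‖φ‖ ^ 2 - ν⁻¹ * ‖Z.generator ⟨φ, hφ⟩‖ ^ 2 := by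
  intro hS7 ω₂ lam β γ hω₂ hlam hβ hγ hH
  obtain ⟨T₀, hT₀, hT⟩ := hS7 ω₂ lam β γ hω₂ hlam hβ hγ hH
  refine ⟨T₀, hT₀, fun T hTpos hTlt D Z hcar hGibbs hSS hRev hsc => ?_⟩
  obtain ⟨c, ν₀, hc, hν₀, hfloor⟩ := hT T hTpos hTlt D Z hcar hGibbs hSS hRev hsc
  exact ⟨c, ν₀, hc, hν₀, Z.trialVectors_of_abelFunctional_floor hRev hsc hfloor⟩

/-- **Stub 7 ⟺ trial vectors**: the registered signature of `stub_fgrPositivity` is equivalent to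
its static trial-vector form (TV) — the census statement "the only content of S7 is the
construction of all-orders dressed trial vectors `φ_ν` with a uniform variational value `c > 0`
for the Gibbs state of `pinnedChain` at small `T`", with a decl name. [folklore] -/
theorem stub_fgrPositivity_iff_trialVectors :
    (∀ ω₂ lam β γ : ℝ, 0 < ω₂ → 0 < lam → 0 < β → 0 < γ →
      Literature.MathematicalPhysics.KineticTheory.PhononBoltzmann.HasOddSectorGap ω₂ lam β →
      ∃ T₀ : ℝ, 0 < T₀ ∧ ∀ T : ℝ, 0 < T → T < T₀ →
        ∀ (D : Literature.MathematicalPhysics.KineticTheory.HeatConduction.InfiniteChainDynamics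
            (Literature.MathematicalPhysics.KineticTheory.HeatConduction.pinnedChain ω₂ lam β γ))
          (Z : Literature.MathematicalPhysics.KineticTheory.HeatConduction.ZeroWavenumberData
            (Literature.MathematicalPhysics.KineticTheory.HeatConduction.pinnedChain ω₂ lam β γ) D),
          D.carrier =
              (Literature.MathematicalPhysics.KineticTheory.HeatConduction.pinnedChain
                ω₂ lam β γ).bmGood →
          (Literature.MathematicalPhysics.KineticTheory.HeatConduction.pinnedChain
              ω₂ lam β γ).IsChainGibbsMeasure T Z.μ →
          (Literature.MathematicalPhysics.KineticTheory.HeatConduction.pinnedChain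
              ω₂ lam β γ).HasSuperstabilityEstimate Z.μ →
          Z.HasMomentumReversal →
          (∀ ψ : Literature.MathematicalPhysics.KineticTheory.HeatConduction.ZeroWavenumberSpace Z,
            Continuous fun t : ℝ => Z.koopman t ψ) →
          ∃ c ν₀ : ℝ, 0 < c ∧ 0 < ν₀ ∧ ∀ ν : ℝ, 0 < ν → ν < ν₀ →
            c ≤ MeasureTheory.integral (MeasureTheory.volume.restrict (Set.Ioi (0:ℝ)))
              (fun t : ℝ => Real.exp (-(ν * t)) * D.currentCorrelation Z.μ t)) ↔
    (∀ ω₂ lam β γ : ℝ, 0 < ω₂ → 0 < lam → 0 < β → 0 < γ →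
      Literature.MathematicalPhysics.KineticTheory.PhononBoltzmann.HasOddSectorGap ω₂ lam β →
      ∃ T₀ : ℝ, 0 < T₀ ∧ ∀ T : ℝ, 0 < T → T < T₀ →
        ∀ (D : Literature.MathematicalPhysics.KineticTheory.HeatConduction.InfiniteChainDynamics
            (Literature.MathematicalPhysics.KineticTheory.HeatConduction.pinnedChain ω₂ lam β γ))
          (Z : Literature.MathematicalPhysics.KineticTheory.HeatConduction.ZeroWavenumberData
            (Literature.MathematicalPhysics.KineticTheory.HeatConduction.pinnedChain ω₂ lam β γ) D),
          D.carrier =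
              (Literature.MathematicalPhysics.KineticTheory.HeatConduction.pinnedChain
                ω₂ lam β γ).bmGood →
          (Literature.MathematicalPhysics.KineticTheory.HeatConduction.pinnedChain
              ω₂ lam β γ).IsChainGibbsMeasure T Z.μ →
          (Literature.MathematicalPhysics.KineticTheory.HeatConduction.pinnedChain
              ω₂ lam β γ).HasSuperstabilityEstimate Z.μ →
          Z.HasMomentumReversal →
          (∀ ψ : Literature.MathematicalPhysics.KineticTheory.HeatConduction.ZeroWavenumberSpace Z,
            Continuous fun t : ℝ => Z.koopman t ψ) →
          ∃ c ν₀ : ℝ, 0 < c ∧ 0 < ν₀ ∧ ∀ ν : ℝ, 0 < ν → ν < ν₀ →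
            ∃ (φ : Literature.MathematicalPhysics.KineticTheory.HeatConduction.ZeroWavenumberSpace Z)
              (hφ : φ ∈ Z.toFluctuationDynamics.generatorDomain),
              c ≤ 2 * ⟪Z.currentClass, φ⟫_ℝ - ν * ‖φ‖ ^ 2 - ν⁻¹ * ‖Z.generator ⟨φ, hφ⟩‖ ^ 2) :=
  ⟨trialVectors_of_stub_fgrPositivity, stub_fgrPositivity_of_trialVectors⟩

end Summit.AtomisticToContinuum.FouriersLaw.Theorems.MourreDissolution

end
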